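import Summits.QuantumFields.YangMills.Theorems.BalabanUVNodesK2NamedJetsRunRemAt

/-!
# CRIT-2 probe for idea-5 g8 `two-bound-activity-interpolation` (K2⁷ stmt-QuantumFields-20543)

COSTUME TEST AT LETTER LEVEL (kernel): the card's run-keyed letter `RunDominatedSplit β b γ₀`
(restated VERBATIM from the card's «First lemma», namespace-local) is, up to the free window shrink
the socket texts already quantify (`∃ γ₀, 0 < γ₀ ∧ γ₀ ≤ θ.γ ∧ …`), EQUIVALENT to the plain modulus letter
`RunModulus β b γ₀ := ∃ ω → 0 at 0⁺, |β_k − b_k| ≤ ω(g_k) on in-window runs` (idea-2 ed.2 ∕ idea-5 ed.2.2 currency):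
the card proves `RunDominatedSplit → RunModulus` (Tannery); THIS file proves the converse
`RunModulus → ∃ γ₁ ≤ γ₀, RunDominatedSplit … γ₁` by a ONE-NONZERO-TERM dyadic family — so the ∃ι-letter
forgets the mechanism; the card's content lives only in a PINNED family (S-REPR ∧ S-LIN).
-/

namespace Summit.QuantumFields.YangMills.Cruxes.EndpointGivenBR13SepCoPH.Crit2Idea5g8

open Literature.MathematicalPhysics.QuantumFieldTheory.Balaban1983to89
open FlowStep
open Filter Topology

noncomputable section

/-- The card's letter, VERBATIM (idea-5 g8 «First lemma»). -/
def RunDominatedSplit (β : HBeta) (b : ℕ → ℝ) (γ₀ : ℝ) : Prop :=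
  ∃ (ι : Type) (I : ι → (k : ℕ) → (Fin (k + 1) → ℝ) → ℝ) (A M : ι → ℝ),
    (∀ i, 0 ≤ A i) ∧ (∀ i, 0 ≤ M i) ∧ Summable M ∧
    ∀ n gs, RGEqH n β gs → Step.InInterval γ₀ n gs → ∀ k, k ≤ n →
      HasSum (fun i => I i k (prefixOf gs k)) (β k (prefixOf gs k) - b k) ∧
      ∀ i, |I i k (prefixOf gs k)| ≤ M i ∧ |I i k (prefixOf gs k)| ≤ A i * gs k

/-- The plain run-wise MODULUS letter (the conclusion shape of the card's `runModulus_of_runDominatedSplit`). -/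
def RunModulus (β : HBeta) (b : ℕ → ℝ) (γ₀ : ℝ) : Prop :=
  ∃ ω : ℝ → ℝ, Tendsto ω (𝓝[>] 0) (𝓝 0) ∧
    ∀ n gs, RGEqH n β gs → Step.InInterval γ₀ n gs → ∀ k, k ≤ n → |β k (prefixOf gs k) - b k| ≤ ω (gs k)

/-- GENERIC DYADIC ONE-TERM FAMILY: any quantity `r s` with `|r s| ≤ ω (g s)`, `ω → 0` at `0⁺`, and `|r s| ≤ B`
is the sum of a family `I i s` (one nonzero term) dominated by a summable `M` AND termwise by `A i * g s`,
with `A`, `M` depending on `ω`, `B` only (axioms: standard). -/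
theorem dominatedFamily_of_modulus {S : Type*} (r g : S → ℝ) (ω : ℝ → ℝ) (B : ℝ)
    (hω : Tendsto ω (𝓝[>] (0:ℝ)) (𝓝 0)) :
    ∃ (I : ℕ → S → ℝ) (A M : ℕ → ℝ), (∀ i, 0 ≤ A i) ∧ (∀ i, 0 ≤ M i) ∧ Summable M ∧
      ∀ s, HasSum (fun i => I i s) (r s) ∧
        (0 < g s → |r s| ≤ ω (g s) → |r s| ≤ B → ∀ i, |I i s| ≤ M i ∧ |I i s| ≤ A i * g s) := by
  classical
  have hδ : ∀ n : ℕ, ∃ δ > (0:ℝ), ∀ x, 0 < x → x < δ → |ω x| < (1/2:ℝ) ^ (n + 1) := by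
    intro n
    obtain ⟨δ, hδpos, h⟩ := Metric.tendsto_nhdsWithin_nhds.mp hω ((1/2:ℝ) ^ (n + 1)) (by positivity)
    refine ⟨δ, hδpos, fun x hx hxδ => ?_⟩
    have hx' : dist x 0 < δ := by rwa [Real.dist_eq, sub_zero, abs_of_pos hx]
    have := h (Set.mem_Ioi.mpr hx) hx'
    rwa [Real.dist_eq, sub_zero] at this
  choose δ hδpos hδω using hδ
  let lvl : S → ℕ := fun s => if h : ∃ n, δ n ≤ g s then Nat.find h + 1 else 0
  let B' : ℝ := max (2 * B) 2
  let M : ℕ → ℝ := fun i => B' * (1/2:ℝ) ^ i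
  let A : ℕ → ℝ := fun i => if i = 0 then 0 else B' * (1/2:ℝ) ^ i / δ (i - 1)
  let I : ℕ → S → ℝ := fun i s => if i = lvl s then r s else 0
  have hB'B : 2 * B ≤ B' := le_max_left _ _
  have hB'2 : (2:ℝ) ≤ B' := le_max_right _ _
  have hB'pos : 0 < B' := lt_of_lt_of_le (by norm_num) hB'2
  have hMnn : ∀ i, 0 ≤ M i := fun i => by positivity
  have hAnn : ∀ i, 0 ≤ A i := by
    intro i
    by_cases hi : i = 0
    · simp [A, hi]
    · simp only [A, hi, if_false]
      exact div_nonneg (by positivity) (hδpos _).le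
  refine ⟨I, A, M, hAnn, hMnn, (summable_geometric_two).mul_left B', fun s => ⟨?_, ?_⟩⟩
  · -- one nonzero term
    have : HasSum (fun i => if i = lvl s then r s else 0) (r s) := hasSum_ite_eq (lvl s) (r s)
    exact this
  · intro hg hrω hrB i
    by_cases hi : i = lvl s
    · have hI : I i s = r s := by simp [I, hi]
      rw [hI]
      by_cases h : ∃ n, δ n ≤ g s
      · -- level n₀ + 1
        have hl : lvl s = Nat.find h + 1 := by simp [lvl, h]
        set n₀ := Nat.find h with hn₀
        have hn₀spec : δ n₀ ≤ g s := Nat.find_spec h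
        have hrM : |r s| ≤ B' * (1/2:ℝ) ^ (n₀ + 1) := by
          rcases Nat.eq_zero_or_pos n₀ with h0 | hpos
          · rw [h0]
            have : B ≤ B' * (1/2:ℝ) ^ (0 + 1) := by norm_num; linarith
            exact hrB.trans this
          · have hlt : g s < δ (n₀ - 1) := by
              have := Nat.find_min h (show n₀ - 1 < Nat.find h by omega)
              exact lt_of_not_ge this
            have hω' : |ω (g s)| < (1/2:ℝ) ^ (n₀ - 1 + 1) := hδω (n₀ - 1) (g s) hg hlt
            have heq : n₀ - 1 + 1 = n₀ := by omega
            rw [heq] at hω'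
            have h1 : |r s| < (1/2:ℝ) ^ n₀ := lt_of_le_of_lt (hrω.trans (le_abs_self _)) hω'
            have h2 : (1/2:ℝ) ^ n₀ = 2 * (1/2:ℝ) ^ (n₀ + 1) := by ring
            have h3 : 2 * (1/2:ℝ) ^ (n₀ + 1) ≤ B' * (1/2:ℝ) ^ (n₀ + 1) :=
              mul_le_mul_of_nonneg_right hB'2 (by positivity)
            linarith
        refine ⟨?_, ?_⟩
        · simpa [M, hi, hl] using hrM
        · have hA : A i = B' * (1/2:ℝ) ^ (n₀ + 1) / δ n₀ := by
            simp [A, hi, hl]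
          rw [hA]
          have hδp := hδpos n₀
          calc |r s| ≤ B' * (1/2:ℝ) ^ (n₀ + 1) := hrM
            _ = B' * (1/2:ℝ) ^ (n₀ + 1) / δ n₀ * δ n₀ := by field_simp
            _ ≤ B' * (1/2:ℝ) ^ (n₀ + 1) / δ n₀ * g s :=
                mul_le_mul_of_nonneg_left hn₀spec (div_nonneg (by positivity) hδp.le)
      · -- no level: r s = 0
        have hsmall : ∀ n, |r s| < (1/2:ℝ) ^ (n + 1) := by
          intro n
          have hlt : g s < δ n := lt_of_not_ge fun hle => h ⟨n, hle⟩
          exact lt_of_le_of_lt (hrω.trans (le_abs_self _)) (hδω n (g s) hg hlt)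
        have hr0 : r s = 0 := by
          by_contra hne
          obtain ⟨n, hn⟩ := exists_pow_lt_of_lt_one (abs_pos.mpr hne) (by norm_num : (1/2:ℝ) < 1)
          have := hsmall n
          have h4 : (1/2:ℝ) ^ (n + 1) ≤ (1/2:ℝ) ^ n :=
            pow_le_pow_of_le_one (by norm_num) (by norm_num) (Nat.le_succ n)
          linarith
        rw [hr0, abs_zero]
        exact ⟨hMnn i, mul_nonneg (hAnn i) hg.le⟩
    · have hI : I i s = 0 := by simp [I, hi]
      rw [hI, abs_zero]
      exact ⟨hMnn i, mul_nonneg (hAnn i) hg.le⟩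

/-- **COSTUME (converse of the card's `runModulus_of_runDominatedSplit`)**: a run-wise modulus gives a run-wise
dominated split on a (possibly smaller) window — the letter `RunDominatedSplit` carries no information beyond the
modulus letter once the window is existentially quantified (as the socket texts do). -/
theorem runDominatedSplit_of_runModulus {β : HBeta} {b : ℕ → ℝ} {γ₀ : ℝ} (hγ₀ : 0 < γ₀)
    (h : RunModulus β b γ₀) : ∃ γ₁, 0 < γ₁ ∧ γ₁ ≤ γ₀ ∧ RunDominatedSplit β b γ₁ := by
  obtain ⟨ω, hω, hrun⟩ := h
  obtain ⟨δ, hδpos, hδ⟩ := Metric.tendsto_nhdsWithin_nhds.mp hω 1 one_pos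
  refine ⟨min γ₀ (δ / 2), lt_min hγ₀ (by linarith), min_le_left _ _, ?_⟩
  obtain ⟨I, A, M, hA, hM, hsum, hI⟩ :=
    dominatedFamily_of_modulus (S := Σ k : ℕ, (Fin (k + 1) → ℝ))
      (fun s => β s.1 s.2 - b s.1) (fun s => s.2 (Fin.last s.1)) ω 1 hω
  refine ⟨ℕ, fun i k p => I i ⟨k, p⟩, A, M, hA, hM, hsum, ?_⟩
  intro n gs hrg hIw k hk
  have hk' := hI ⟨k, prefixOf gs k⟩
  refine ⟨hk'.1, ?_⟩
  have hgpos : 0 < gs k := (hIw k hk).1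
  have hgle : gs k ≤ min γ₀ (δ / 2) := (hIw k hk).2
  have hω1 : |ω (gs k)| < 1 := by
    have hd : dist (gs k) 0 < δ := by
      rw [Real.dist_eq, sub_zero, abs_of_pos hgpos]
      linarith [min_le_right γ₀ (δ / 2)]
    have := hδ (Set.mem_Ioi.mpr hgpos) hd
    rwa [Real.dist_eq, sub_zero] at this
  have hmod : |β k (prefixOf gs k) - b k| ≤ ω (gs k) :=
    hrun n gs hrg (fun j hj => ⟨(hIw j hj).1, (hIw j hj).2.trans (min_le_left _ _)⟩) k hk
  have hbd : |β k (prefixOf gs k) - b k| ≤ 1 := hmod.trans ((le_abs_self _).trans hω1.le)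
  exact hk'.2 hgpos hmod hbd

/-- Window-existential form: the two sockets coincide (modulus ⟹ split; the other direction is the card's Tannery road). -/
theorem exists_runDominatedSplit_of_exists_runModulus {β : HBeta} {b : ℕ → ℝ} {c : ℝ}
    (h : ∃ γ₀, 0 < γ₀ ∧ γ₀ ≤ c ∧ RunModulus β b γ₀) : ∃ γ₀, 0 < γ₀ ∧ γ₀ ≤ c ∧ RunDominatedSplit β b γ₀ := by
  obtain ⟨γ₀, hγ₀, hle, hmod⟩ := h
  obtain ⟨γ₁, hγ₁, hγ₁le, hsplit⟩ := runDominatedSplit_of_runModulus hγ₀ hmod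
  exact ⟨γ₁, hγ₁, hγ₁le.trans hle, hsplit⟩

end

end Summit.QuantumFields.YangMills.Cruxes.EndpointGivenBR13SepCoPH.Crit2Idea5g8
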